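import Summits.NavierStokesRegularity.NavierStokesRegularity.Theses.AngularGalerkinLadder
import Summits.NavierStokesRegularity.NavierStokesRegularity.Theorems.NoOverheating.Negative.LadderLimitExposed
import Literature.Analysis.FluidPDE.TypeIAncientMildClassical
import Literature.Analysis.FluidPDE.PineauVicolRSSChaeWolf
import Literature.Analysis.FluidPDE.ChaeWolfRemovingDSSProofs
import Literature.Analysis.FluidPDE.NSLerayStrongLocalExistence

/-!
# The SELF-SIMILAR (Leray-type) stratum is EXCLUDED from the window sequences of route
# `AngularGalerkinLadder` — and, more generally, profiles sharing one extra plain-DSS factor in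
# Chae–Wolf's fine range (stratum (S5), complementing `ExcludedStrataCensus` (S0)–(S4))

Circuit seat (ns-blowup-circuit g10), plain Negative lane of crux K2 `NoOverheating`
(`--supports` item stmt-NavierStokesRegularity-19960; no definition, no positive route statement,
no new Literature fact).

## Why this stratum is not (S2)

`ExcludedStrataCensus` (KJ-38) excludes, among others, window sequences whose OWN recorded factor
is fine (`cmax ^ q < κ(C₀)` with `Rₙ ^ q → 1`, stratum (S2), Chae–Wolf 2017 Thm 1.3). An EXACTLY
SELF-SIMILAR rung profile — a Leray-type backward profile `u(t,x) = (−t)^{-1/2} U(x/√−t)` of the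
truncated system `NS_L`, the object of the cell's MODEL line «Z2-OCT / OCT-P93» (an `O_h`-symmetric
poloidal similarity root of `NS₄` reproduced on two float64 codes, ℓ-ladder to rungs 6 and 8) — is
`λ`-DSS for EVERY factor `λ > 0`, so K2 may RECORD it with any factor `c ∈ [cmin, cmax]` it likes
(e.g. `c = 100`, any rotation `R` in the profile's symmetry group): the window's own factor says
nothing, (S2) does not bite, and the question «can Leray-type rung profiles populate K2's
windows?» needs its own theorem. Answer: NO, unconditionally.

## Contents (all kernel-checked, standard axioms)

* `isDiscretelySelfSimilar_cutoff_of_tendsto` — slice-wise pointwise limits on `t < 0` of `λ`-DSS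
  fields give a `λ`-DSS field after the `t ≥ 0` cutoff (pure bookkeeping).
* `no_windowSequence_extraFineFactor` — for every `C₀` there is `c₁ = λ₁(C₀) > 1` (Chae–Wolf's
  threshold, the tree's PROVED `chaeWolf2017_removing_dss_holds`) such that NO admissible window
  sequence (`1 < cmin`, `0 < δ`, `εₙ → 0`, a window profile with constant `C₀` at every index —
  ANY rotations `Rₙ`, ANY window `[cmin, cmax]`) has all its profiles additionally plainly `λ`-DSS
  for one common `λ ∈ (1, c₁)`: the exposed ladder limit (`exists_ladderLimit_typeI`, K3 machinery,
  p481922/p492811/p496546) inherits `λ`-DSS pointwise and Chae–Wolf removes it, against its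
  non-triviality.
* `no_selfSimilar_windowSequence` — NO admissible window sequence consists of self-similar profiles
  (no threshold left: pick `λ = (1 + c₁)/2`); `no_windowSequence_frequently_selfSimilar` — not even
  infinitely many of them.
* `not_cofinal_and_noOverheating_selfSimilar`, `rungBlowupCofinal_false_of_noOverheating_selfSimilar`
  — read on the open cruxes: K1 `RungBlowupCofinal` (19959) ∧ «K2 met by self-similar profiles» is
  FALSE.
* `not_tendsto_defectSize_of_selfSimilar_rungProfiles` — THE LERAY-LINE LAW: a sequence of
  self-similar rung solutions on `(−∞,0)` (any rungs `Lₙ`) with ONE Type-I constant `C₀`, an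
  amplitude floor `δ > 0` at `t = −1` and scale-invariant defect sizes `εₙ` has `εₙ ↛ 0`. On the
  cell's ℓ-ladder of `O_h` Leray-type roots (rungs 4, 6, 8, …) this says: if the roots are genuine
  rung profiles then, along the ladder, the Galerkin defect size stays bounded below, or the Type-I
  constant escapes, or the amplitude collapses — OVERHEATING IS FORCED on the Leray line. Such
  profiles can witness INSTANCES of K1 (`RungIsSingular L`), never K2's windows: «K1-capable,
  K2-incapable», exactly like the axisymmetric stratum (KJ-32, `AxisymmetricWindowsExcluded`).

LABEL: KERNEL. WHAT THIS IS NOT: not NS — no rung solution, profile or window is constructed and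
nothing is claimed about the float64 root OCT-P93 (a MODEL object of a Galerkin-TRUNCATED system);
no item changes verdict (`¬NoOverheating` is not claimed: vacuous without K1 instances); the
coarse-window, genuinely-DSS (non-self-similar), non-axisymmetric region of K2 is untouched.
References: [cite: ChaeWolf2017RemovingDSS, Theorem 1.3 and §3 (arXiv:1610.09464 pp. 3, 8–9)];
[cite: Tsai1998, Theorem 1 (the self-similar limit inside Chae–Wolf's proof)];
[cite: KochNadirashviliSereginSverak2009, §4 and Lemma 6.1 (arXiv:0709.3599)];
[cite: NecasRuzickaSverak1996, (1.3)–(1.5)].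
-/

namespace Summit.NavierStokesRegularity.AngularGalerkinLadderSelfSimilarWindowsExcluded

open Set Filter MeasureTheory Topology Function
open Literature.Analysis Literature.Analysis.FluidPDE
open Summit.NavierStokesRegularity.FluidComputer
open Summit.NavierStokesRegularity.NavierStokesRegularity.Theses.AngularGalerkinLadder
open Summit.NavierStokesRegularity.AngularGalerkinLadderLadderLimit

/-! ### §0 DSS passes to slice-wise pointwise limits (with the `t ≥ 0` cutoff) -/

section Cutoff

variable {E : Type*} [NormedAddCommGroup E] [NormedSpace ℝ E]
variable {F : Type*} [NormedAddCommGroup F] [NormedSpace ℝ F]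

/-- If every `uₙ` is `λ`-DSS (`λ ≠ 0`) and `uₙ(t, ·) → v(t, ·)` pointwise for every `t < 0`, then
the cutoff field `w(t,x) = v(t,x)` (`t < 0`), `0` (`t ≥ 0`) is `λ`-DSS: for `t < 0` both
`λ uₙ(λ²t, λx)` and `uₙ(t,x)` converge, and they are equal; for `t ≥ 0` both sides vanish.
[folklore] -/
theorem isDiscretelySelfSimilar_cutoff_of_tendsto {lam : ℝ} (hlam : lam ≠ 0)
    {u : ℕ → ℝ → E → F} {v : ℝ → E → F} (hu : ∀ n, IsDiscretelySelfSimilar lam (u n))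
    (hlim : ∀ t < 0, ∀ x, Tendsto (fun n => u n t x) atTop (𝓝 (v t x))) :
    IsDiscretelySelfSimilar lam (fun t x => if t < 0 then v t x else 0) := by
  unfold IsDiscretelySelfSimilar
  funext t x
  rw [nsRescale_apply]
  by_cases ht : t < 0
  · have hlt : lam ^ 2 * t < 0 := mul_neg_of_pos_of_neg (by positivity) ht
    simp only [if_pos ht, if_pos hlt]
    have h1 : Tendsto (fun n => lam • u n (lam ^ 2 * t) (lam • x)) atTop
        (𝓝 (lam • v (lam ^ 2 * t) (lam • x))) :=
      (hlim _ hlt _).const_smul lam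
    have h2 : (fun n => lam • u n (lam ^ 2 * t) (lam • x)) = fun n => u n t x := by
      funext n
      have := congrFun (congrFun (hu n) t) x
      rwa [nsRescale_apply] at this
    rw [h2] at h1
    exact tendsto_nhds_unique h1 (hlim t ht x)
  · have hge : ¬ lam ^ 2 * t < 0 := not_lt.2 (mul_nonneg (sq_nonneg _) (not_lt.1 ht))
    simp only [if_neg ht, if_neg hge, smul_zero]

end Cutoff

/-! ### §0b Two bookkeeping facts (the same lines as in `FineRatioWindowsExcluded`, kept private so
that this file imports no other route-dependent module) -/

/-- A field of the KNSS-gauge Type-I class is a classical Navier–Stokes solution (`ν = 1`, no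
force) on all of `(−∞, 0)` for ONE smooth pressure (windows `(−(k+1), 0)` by
`IsTypeIAncientMild.exists_isClassicalNSSolutionOn_Ioo`, patched by
`IsClassicalNSSolutionOn.exists_pressure_Iio_of_Ioo`). [cite: KochNadirashviliSereginSverak2009, §4 p. 8 (arXiv:0709.3599)] -/
private theorem exists_classical_Iio' {C : ℝ}
    {v : ℝ → EuclideanSpace ℝ (Fin 3) → EuclideanSpace ℝ (Fin 3)} (hv : IsTypeIAncientMild C v) :
    ∃ P : ℝ → EuclideanSpace ℝ (Fin 3) → ℝ, IsClassicalNSSolutionOn (Iio 0) 1 0 v P := by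
  have hwin : ∀ k : ℕ, ∃ q : ℝ → EuclideanSpace ℝ (Fin 3) → ℝ,
      IsClassicalNSSolutionOn (Ioo (-((k : ℝ) + 1)) 0) 1 0 v q := fun k =>
    hv.exists_isClassicalNSSolutionOn_Ioo (t₀ := -((k : ℝ) + 1)) (by
      have : (0 : ℝ) ≤ k := Nat.cast_nonneg k
      linarith)
  choose q hq using hwin
  refine IsClassicalNSSolutionOn.exists_pressure_Iio_of_Ioo (a := fun k : ℕ => -((k : ℝ) + 1)) hq
    fun s _ => ⟨⌈-s⌉₊, ?_⟩
  have h1 : -s ≤ (⌈-s⌉₊ : ℝ) := Nat.le_ceil (-s)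
  show -((⌈-s⌉₊ : ℝ) + 1) < s
  linarith

/-- A window profile forces `0 < C₀` when `0 < δ` (the floor `δ ≤ ‖u(−1, x)‖` sits under the
Type-I envelope `C₀/(‖x‖ + 1)`). [folklore] -/
private theorem typeI_const_pos_of_window' {L : ℕ} {C₀ cmin cmax δ ε c : ℝ}
    {R : EuclideanSpace ℝ (Fin 3) ≃ₗᵢ[ℝ] EuclideanSpace ℝ (Fin 3)}
    {u : ℝ → EuclideanSpace ℝ (Fin 3) → EuclideanSpace ℝ (Fin 3)}
    {p : ℝ → EuclideanSpace ℝ (Fin 3) → ℝ}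
    {d : ℝ → EuclideanSpace ℝ (Fin 3) → EuclideanSpace ℝ (Fin 3)} (hδ : 0 < δ)
    (hW : AngularLadder.IsWindowProfile L C₀ cmin cmax δ ε c R u p d) : 0 < C₀ := by
  obtain ⟨x, hx⟩ := hW.2.2.2.1
  have hTI := hW.1.hasTypeIDecay (-1) (by norm_num) x
  have hden : 0 < ‖x‖ + Real.sqrt (-(-1 : ℝ)) := by
    have : 0 < Real.sqrt (-(-1 : ℝ)) := Real.sqrt_pos.2 (by norm_num)
    positivity
  by_contra hC
  have h0 : C₀ / (‖x‖ + Real.sqrt (-(-1 : ℝ))) ≤ 0 :=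
    div_nonpos_of_nonpos_of_nonneg (not_lt.1 hC) hden.le
  linarith

/-! ### §1 Stratum (S5): one extra plain-DSS factor in Chae–Wolf's fine range -/

/-- **No admissible window sequence whose profiles share an extra plain-DSS factor in the fine
range.** For every `C₀` there is `c₁ = λ₁(C₀) > 1` such that constants `1 < cmin`, `0 < δ`,
defect sizes `εₙ → 0`, a window rung profile with constant `C₀` at every index — ANY rotations
`Rₙ`, ANY window `[cmin, cmax]` — and ONE `λ ∈ (1, c₁)` with every `uₙ` plainly `λ`-DSS are
contradictory: the ladder limit `v` (`exists_ladderLimit_typeI`) is, after the `t ≥ 0` cutoff, a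
`λ`-DSS classical Type-I (`C₀`) ancient solution for one pressure on the whole past
(KNSS §4 / Fabes–Jones–Rivière, as in `FineRatioWindowsExcluded`), which Chae–Wolf 2017 Thm 1.3 (`chaeWolf2017_removing_dss_holds`) removes,
against `¬ (∀ t < 0, v t =ᵐ 0)`. (`C₀ ≤ 0` is vacuous by the amplitude floor.)
[cite: ChaeWolf2017RemovingDSS, Theorem 1.3 (arXiv:1610.09464 p. 3)] -/
theorem no_windowSequence_extraFineFactor (C₀ : ℝ) :
    ∃ c₁ : ℝ, 1 < c₁ ∧ ∀ {cmin cmax δ lam : ℝ} {L : ℕ → ℕ} {ε c : ℕ → ℝ}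
      {R : ℕ → (EuclideanSpace ℝ (Fin 3) ≃ₗᵢ[ℝ] EuclideanSpace ℝ (Fin 3))}
      {u : ℕ → ℝ → EuclideanSpace ℝ (Fin 3) → EuclideanSpace ℝ (Fin 3)}
      {p : ℕ → ℝ → EuclideanSpace ℝ (Fin 3) → ℝ}
      {d : ℕ → ℝ → EuclideanSpace ℝ (Fin 3) → EuclideanSpace ℝ (Fin 3)},
      1 < lam → lam < c₁ → 1 < cmin → 0 < δ → Tendsto ε atTop (𝓝 0) →
      (∀ n, AngularLadder.IsWindowProfile (L n) C₀ cmin cmax δ (ε n) (c n) (R n) (u n) (p n)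
        (d n)) →
      (∀ n, IsDiscretelySelfSimilar lam (u n)) → False := by
  by_cases hC₀ : 0 < C₀
  · obtain ⟨c₁, hc₁, H⟩ := chaeWolf2017_removing_dss_holds C₀ hC₀
    refine ⟨c₁, hc₁, fun {cmin cmax δ lam L ε c R u p d} hlam1 hlamc hcmin hδ hε hW hss => ?_⟩
    obtain ⟨φ, c', R', v, -, -, -, -, hpt, -, -, -, hTAM, -, -, hTI, -, hnz⟩ :=
      exists_ladderLimit_typeI hcmin hδ hε hW
    -- the cutoff of the ladder limit is `λ`-DSS
    set w : ℝ → EuclideanSpace ℝ (Fin 3) → EuclideanSpace ℝ (Fin 3) :=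
      fun t x => if t < 0 then v t x else 0 with hwdef
    have hw : IsDiscretelySelfSimilar lam w :=
      isDiscretelySelfSimilar_cutoff_of_tendsto (by positivity) (fun n => hss (φ n)) hpt
    -- one pressure on the whole past for the limit, transported to the cutoff
    obtain ⟨P, hP⟩ := exists_classical_Iio' hTAM
    have hwv : ∀ t ∈ Iio (0 : ℝ), w t = v t := fun t ht => by
      funext x
      simp only [hwdef, if_pos (mem_Iio.1 ht)]
    have hPw : IsClassicalNSSolutionOn (Iio 0) 1 0 w P := hP.congr_velocity hwv
    have hTIw : HasTypeIDecay C₀ w := fun t ht x => by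
      simp only [hwdef, if_pos ht]
      exact hTI t ht x
    have hz : ∀ t < 0, ∀ x, w t x = 0 := H lam hlam1 hlamc w P hPw hw hTIw
    refine hnz fun t ht => Eventually.of_forall fun x => ?_
    have h1 := hz t ht x
    simp only [hwdef, if_pos ht] at h1
    simpa using h1
  · refine ⟨2, one_lt_two, fun {cmin cmax δ lam L ε c R u p d} _ _ _ hδ _ hW _ => ?_⟩
    exact hC₀ (typeI_const_pos_of_window' hδ (hW 0))

/-! ### §2 The self-similar (Leray-type) stratum -/

/-- **No admissible window sequence of SELF-SIMILAR profiles** — any `C₀`, any rotations, any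
window, no threshold: a self-similar field is `λ`-DSS for every `λ > 0`
(`IsSelfSimilar.isDiscretelySelfSimilar`), in particular for `λ = (1 + λ₁(C₀))/2` in Chae–Wolf's
fine range, and `no_windowSequence_extraFineFactor` applies. [cite: ChaeWolf2017RemovingDSS, Theorem 1.3 (arXiv:1610.09464 p. 3)] -/
theorem no_selfSimilar_windowSequence {C₀ cmin cmax δ : ℝ} {L : ℕ → ℕ} {ε c : ℕ → ℝ}
    {R : ℕ → (EuclideanSpace ℝ (Fin 3) ≃ₗᵢ[ℝ] EuclideanSpace ℝ (Fin 3))}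
    {u : ℕ → ℝ → EuclideanSpace ℝ (Fin 3) → EuclideanSpace ℝ (Fin 3)}
    {p : ℕ → ℝ → EuclideanSpace ℝ (Fin 3) → ℝ}
    {d : ℕ → ℝ → EuclideanSpace ℝ (Fin 3) → EuclideanSpace ℝ (Fin 3)}
    (hcmin : 1 < cmin) (hδ : 0 < δ) (hε : Tendsto ε atTop (𝓝 0))
    (hW : ∀ n, AngularLadder.IsWindowProfile (L n) C₀ cmin cmax δ (ε n) (c n) (R n) (u n) (p n)
      (d n))
    (hss : ∀ n, IsSelfSimilar (u n)) : False := by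
  obtain ⟨c₁, hc₁, H⟩ := no_windowSequence_extraFineFactor C₀
  have h1 : (1 : ℝ) < (1 + c₁) / 2 := by linarith
  have h2 : (1 + c₁) / 2 < c₁ := by linarith
  exact H h1 h2 hcmin hδ hε hW fun n => (hss n).isDiscretelySelfSimilar (by linarith)

/-- **Not even frequently**: an admissible window sequence contains at most finitely many
self-similar profiles (pass to the self-similar sub-window-sequence). [cite: ChaeWolf2017RemovingDSS, Theorem 1.3 (arXiv:1610.09464 p. 3)] -/
theorem no_windowSequence_frequently_selfSimilar {C₀ cmin cmax δ : ℝ} {L : ℕ → ℕ} {ε c : ℕ → ℝ}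
    {R : ℕ → (EuclideanSpace ℝ (Fin 3) ≃ₗᵢ[ℝ] EuclideanSpace ℝ (Fin 3))}
    {u : ℕ → ℝ → EuclideanSpace ℝ (Fin 3) → EuclideanSpace ℝ (Fin 3)}
    {p : ℕ → ℝ → EuclideanSpace ℝ (Fin 3) → ℝ}
    {d : ℕ → ℝ → EuclideanSpace ℝ (Fin 3) → EuclideanSpace ℝ (Fin 3)}
    (hcmin : 1 < cmin) (hδ : 0 < δ) (hε : Tendsto ε atTop (𝓝 0))
    (hW : ∀ n, AngularLadder.IsWindowProfile (L n) C₀ cmin cmax δ (ε n) (c n) (R n) (u n) (p n)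
      (d n))
    (hfr : ∃ᶠ n in atTop, IsSelfSimilar (u n)) : False := by
  obtain ⟨ψ, hψ, hle⟩ := extraction_of_frequently_atTop hfr
  exact no_selfSimilar_windowSequence (L := L ∘ ψ) (ε := ε ∘ ψ) (c := c ∘ ψ) (R := R ∘ ψ)
    (u := u ∘ ψ) (p := p ∘ ψ) (d := d ∘ ψ) hcmin hδ (hε.comp hψ.tendsto_atTop)
    (fun n => hW (ψ n)) hle

/-! ### §3 Readings on the open cruxes K1 (19959) and K2 (19960) -/

/-- **K1 ∧ (K2 met by self-similar profiles) is FALSE.** `RungBlowupCofinal` together with a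
`NoOverheating` whose window profiles are self-similar (Leray-type) is contradictory: the window
sequence the deciding theorem `closes` would build (rungs `Lₙ ≥ n`, defect sizes `ε(Lₙ) → 0`) is
excluded by `no_selfSimilar_windowSequence`. K2, if it holds at all, is met by genuinely
DISCRETELY (not exactly) self-similar profiles from some level on. [cite: ChaeWolf2017RemovingDSS, Theorem 1.3 (arXiv:1610.09464 p. 3)] -/
theorem not_cofinal_and_noOverheating_selfSimilar :
    ¬ (RungBlowupCofinal ∧
      ∃ (C₀ cmin cmax δ : ℝ) (L₀ : ℕ) (ε : ℕ → ℝ), 1 < cmin ∧ 0 < δ ∧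
        Tendsto ε atTop (𝓝 0) ∧
        ∀ L ≥ L₀, AngularLadder.RungIsSingular L →
          ∃ (c : ℝ) (R : EuclideanSpace ℝ (Fin 3) ≃ₗᵢ[ℝ] EuclideanSpace ℝ (Fin 3))
            (u : ℝ → EuclideanSpace ℝ (Fin 3) → EuclideanSpace ℝ (Fin 3))
            (p : ℝ → EuclideanSpace ℝ (Fin 3) → ℝ)
            (d : ℝ → EuclideanSpace ℝ (Fin 3) → EuclideanSpace ℝ (Fin 3)),
            AngularLadder.IsWindowProfile L C₀ cmin cmax δ (ε L) c R u p d ∧ IsSelfSimilar u) := by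
  rintro ⟨h₁, C₀, cmin, cmax, δ, L₀, ε, hcmin, hδ, hε, hwin⟩
  choose L hLge hLsing using fun n : ℕ => h₁ (max L₀ n)
  choose c R u p d hW hss using fun n : ℕ =>
    hwin (L n) (le_trans (le_max_left _ _) (hLge n)) (hLsing n)
  have hε' : Tendsto (fun n : ℕ => ε (L n)) atTop (𝓝 0) :=
    hε.comp (tendsto_atTop_mono (fun n => le_trans (le_max_right _ _) (hLge n)) tendsto_id)
  exact no_selfSimilar_windowSequence hcmin hδ hε' hW hss

/-- Negative edge on K1 for the census: a `NoOverheating` met by self-similar (Leray-type) rung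
profiles refutes `RungBlowupCofinal`. [cite: ChaeWolf2017RemovingDSS, Theorem 1.3] -/
theorem rungBlowupCofinal_false_of_noOverheating_selfSimilar {C₀ cmin cmax δ : ℝ} {L₀ : ℕ}
    {ε : ℕ → ℝ} (hcmin : 1 < cmin) (hδ : 0 < δ) (hε : Tendsto ε atTop (𝓝 0))
    (hwin : ∀ L ≥ L₀, AngularLadder.RungIsSingular L →
      ∃ (c : ℝ) (R : EuclideanSpace ℝ (Fin 3) ≃ₗᵢ[ℝ] EuclideanSpace ℝ (Fin 3))
        (u : ℝ → EuclideanSpace ℝ (Fin 3) → EuclideanSpace ℝ (Fin 3))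
        (p : ℝ → EuclideanSpace ℝ (Fin 3) → ℝ)
        (d : ℝ → EuclideanSpace ℝ (Fin 3) → EuclideanSpace ℝ (Fin 3)),
        AngularLadder.IsWindowProfile L C₀ cmin cmax δ (ε L) c R u p d ∧ IsSelfSimilar u) :
    ¬ RungBlowupCofinal := fun h₁ =>
  not_cofinal_and_noOverheating_selfSimilar ⟨h₁, C₀, cmin, cmax, δ, L₀, ε, hcmin, hδ, hε, hwin⟩

/-! ### §4 The Leray-line law: overheating is forced on self-similar rung profiles -/

/-- **The Leray-line law.** Let `(uₙ, pₙ, dₙ)` be rung solutions of the ladder on `(−∞, 0)`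
(`ν = 1`, rungs `Lₙ` arbitrary) which are SELF-SIMILAR, obey ONE Type-I bound `C₀`, keep an
amplitude floor `δ ≤ ‖uₙ(−1, xₙ)‖` (`δ > 0`), and whose Galerkin defects have scale-invariant sizes
`εₙ` (`‖dₙ(t,x)‖ ≤ εₙ/(‖x‖+√−t)³`). Then `εₙ ↛ 0`. (Record each `uₙ` as a window profile with
factor `2` and rotation `1` — a self-similar field is `2`-DSS — and apply
`no_selfSimilar_windowSequence` with the window `[2, 2]`.) Census reading for the ℓ-ladder of
Leray-type `O_h` roots (MODEL OCT-P93, rungs 4/6/8/…): if the roots are genuine rung profiles,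
then along the ladder the defect size stays bounded below OR the Type-I constant escapes OR the
amplitude collapses — the Leray line can witness instances of K1, never K2.
[cite: ChaeWolf2017RemovingDSS, Theorem 1.3 (arXiv:1610.09464 p. 3)]
[cite: NecasRuzickaSverak1996, (1.3)–(1.5)] -/
theorem not_tendsto_defectSize_of_selfSimilar_rungProfiles {C₀ δ : ℝ} {L : ℕ → ℕ} {ε : ℕ → ℝ}
    {u : ℕ → ℝ → EuclideanSpace ℝ (Fin 3) → EuclideanSpace ℝ (Fin 3)}
    {p : ℕ → ℝ → EuclideanSpace ℝ (Fin 3) → ℝ}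
    {d : ℕ → ℝ → EuclideanSpace ℝ (Fin 3) → EuclideanSpace ℝ (Fin 3)} (hδ : 0 < δ)
    (hsol : ∀ n, AngularLadder.IsRungSolutionOn (Iio 0) 1 (L n) (u n) (p n) (d n))
    (hss : ∀ n, IsSelfSimilar (u n)) (hTI : ∀ n, HasTypeIDecay C₀ (u n))
    (hamp : ∀ n, ∃ x, δ ≤ ‖u n (-1) x‖)
    (hdef : ∀ n, AngularLadder.HasDefectBound (ε n) (d n)) :
    ¬ Tendsto ε atTop (𝓝 0) := fun hε =>
  no_selfSimilar_windowSequence (C₀ := C₀) (cmin := 2) (cmax := 2) (c := fun _ => 2)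
    (R := fun _ => LinearIsometryEquiv.refl ℝ (EuclideanSpace ℝ (Fin 3))) (L := L) (ε := ε)
    (u := u) (p := p) (d := d) one_lt_two hδ hε
    (fun n => ⟨⟨hsol n, one_lt_two,
      isRotatedDSS_refl_iff.2 ((hss n).isDiscretelySelfSimilar two_pos), hTI n⟩,
      le_rfl, le_rfl, hamp n, hdef n⟩) hss

/-- **The Leray-line law, window form.** For every Type-I constant `C₀` and floor `δ > 0` there
is NO sequence of self-similar rung solutions with constant `C₀`, floor `δ` at `t = −1` and defect
sizes `εₙ → 0` — the three ways out (defect bounded below, `C₀(n) → ∞`, `δ(n) → 0`) are exactly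
«overheating» in the sense of crux K2. [cite: ChaeWolf2017RemovingDSS, Theorem 1.3 (arXiv:1610.09464 p. 3)] -/
theorem no_selfSimilar_rungProfiles_vanishing_defect (C₀ δ : ℝ) (hδ : 0 < δ) :
    ¬ ∃ (L : ℕ → ℕ) (ε : ℕ → ℝ)
        (u : ℕ → ℝ → EuclideanSpace ℝ (Fin 3) → EuclideanSpace ℝ (Fin 3))
        (p : ℕ → ℝ → EuclideanSpace ℝ (Fin 3) → ℝ)
        (d : ℕ → ℝ → EuclideanSpace ℝ (Fin 3) → EuclideanSpace ℝ (Fin 3)),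
        (∀ n, AngularLadder.IsRungSolutionOn (Iio 0) 1 (L n) (u n) (p n) (d n)) ∧
        (∀ n, IsSelfSimilar (u n)) ∧ (∀ n, HasTypeIDecay C₀ (u n)) ∧
        (∀ n, ∃ x, δ ≤ ‖u n (-1) x‖) ∧ (∀ n, AngularLadder.HasDefectBound (ε n) (d n)) ∧
        Tendsto ε atTop (𝓝 0) := by
  rintro ⟨L, ε, u, p, d, hsol, hss, hTI, hamp, hdef, hε⟩
  exact not_tendsto_defectSize_of_selfSimilar_rungProfiles hδ hsol hss hTI hamp hdef hε

end Summit.NavierStokesRegularity.AngularGalerkinLadderSelfSimilarWindowsExcluded
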